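import Summits.BirchSwinnertonDyer.BirchSwinnertonDyer.Theorems.EisensteinPrimesCharLocalInertiaFrobenius
import Summits.BirchSwinnertonDyer.BirchSwinnertonDyer.Theorems.EisensteinPrimesUnrSelmerQuotientCorankChar
import Literature.NumberTheory.EllipticCurves.KellerYin2024.AnomalousLambdaInvariants
import HarnessLib

/-!
# `corank_{ℤ_p}(H¹_{𝓕_nr^{Sf}}/H¹_{𝓕_nr}) ≤ Σ_{w∈Sf} λ(𝒫_w(θ))` for Keller–Yin's character modules over
# the anticyclotomic tower — the `≤` HALF of the `S`-relaxation corank identity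
# `prop125_residualPair_unrSelmer_corank`, IN THE KERNEL (sharp assembly, step 4)

Cell `bsd-eis` (home `run/shared/lean/pub/bsd-eis/`), D-0154 row 4, crux 2 `GoodLatticeBDPValue`
(stmt-BirchSwinnertonDyer-19032), line `halves` v14, stub `stub_imprimCorank`, first conjunct
`prop125_residualPair_unrSelmer_corank` (`zpCorank (H¹_{𝓕_nr^{Sf}}/H¹_{𝓕_nr}) p = Σ_{w∈Sf} charLocalLambda ∅ κ θ w`,
PUB-composed: Pollack–Weston 2011 Prop. A.2 ∘ KY/CGLS Lemma 1.1.1). Seat `bsd-line-x1-p1` (LEAD) — the ASSEMBLY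
assigned to the LEAD by the host (HOME/STATUS l.2395 (2)), importing the width seat `bsd-line-x1-p1-w2`'s per-place
lemma (`CharLocalInertiaFrobenius.zpCorank_le_ite_of_forall_exists`, p609213) into the LEAD's generic character
assembly (`UnrSelmerQuotientCorankChar.zpCorank_unrSelmer_quotient_le_sum_of_loc`, p607760). No lemma of either chain is
restated here.

* **`zpCorank_unrSelmer_quotient_le_sum_charLocalLambda`** — for `K` imaginary quadratic, `p` odd, `κ` ANTICYCLOTOMIC
  with topological generator `γ`, any `vbar`, any character `θ : Γ_K → GL₁(ℤ_p)` with `θ^{p−1} = 1`, and `Sf` = the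
  primes of `K` over `N` ((Heeg) for `N`, `p ∉ w` for `w ∈ Sf`):
  `zpCorank (H¹_{𝓕_nr^{Sf}}(K_∞,(F/𝒪)(θ)) / H¹_{𝓕_nr}) p ≤ Σ_{w∈Sf} charLocalLambda ∅ κ θ w`
  — the quotient embeds in `∏_{w∈Sf} ∏_{η∣w} H¹(I_η, (F/𝒪)(θ))` (`[Γ:Γ_w] = numPlacesAbove κ w` factors at `w`, each
  finitely decomposed by Brink 2007), and the factor at `η ∣ w` contributes corank `≤ 𝟙[θ unramified at w ∧
  θ(Frob_w) ≡ Nw (mod p)]` (ramified: no inertia-fixed `p`-torsion; unramified non-anomalous: the prime-to-`p` part of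
  Frobenius lies in `ker κ` and multiplies tame homomorphisms by `Nw`); `charLocalLambda = numPlacesAbove · 𝟙[…]` by
  definition.
* `zpCorank_unrSelmer_quotient_le_at_residualPair` — the same for each member `θ ∈ {θsub, θquot}` of a residual pair
  (`IsResidualPairOver`: Teichmüller lifts, `θ^{p−1} = 1`), i.e. under the binders of the stub WITHOUT its [RH]
  cotorsion hypothesis.

What this is NOT: not the stub (an EQUALITY; its `≥` half is the surjectivity of the global-to-local map — Poitou–Tate
for `Λ`-adic coefficients, Greenberg 2010 Prop. 3.2.1, tree named fact `Greenberg2016.prop263_sur_of_crk` in the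
big-Galois-representation formalism); not the f-side `rem142_…`; nothing about `E` is proved; BSD / Mazur's MC / IMC2
proved for no curve; 0 stubs close.

References: [KellerYin2024] Prop. 1.2.5, Lemma 1.1.1, Rem. 1.2.3 (arXiv:2402.12781v2 TeX L780–800, L455–462,
L690–712); [CastellaGrossiLeeSkinner2022] Prop. 1.2.5 (proof, (eq:sur1)–(eq:sur2)), Lemma 1.1.1; [GreenbergVatsal2000]
§2 Cor. (2.3), Prop. (2.4) (pp. 20–23); [PollackWeston2011] App. A Prop. A.2; [Brink2007] Thm. 2.
-/

set_option linter.dupNamespace false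
set_option autoImplicit false

noncomputable section

open scoped Classical AddSubgroup

open NumberField IsDedekindDomain Field
  Literature.NumberTheory.EllipticCurves Literature.NumberTheory.EllipticCurves.Castella2018
  Literature.NumberTheory.EllipticCurves.GreenbergSelmer
  Literature.NumberTheory.EllipticCurves.GreenbergVatsal2000 Literature.NumberTheory.GaloisRepresentations
  Literature.NumberTheory.EllipticCurves.KellerYin2024
open Summit.BirchSwinnertonDyer.BirchSwinnertonDyer.Theorems
  Summit.BirchSwinnertonDyer.BirchSwinnertonDyer.Theorems.UnrSelmerQuotientTorsionFiniteChar
  Summit.BirchSwinnertonDyer.BirchSwinnertonDyer.Theorems.UnrSelmerQuotientCorankChar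
  Summit.BirchSwinnertonDyer.BirchSwinnertonDyer.Theorems.CharLocalInertiaFrobenius

namespace Summit.BirchSwinnertonDyer.BirchSwinnertonDyer.Theorems.UnrSelmerQuotientCorankLocalLambda

variable {K : Type} [Field K] [NumberField K] {p : ℕ} [Fact p.Prime]

/-- **`corank_{ℤ_p}(H¹_{𝓕_nr^{Sf}}(K_∞, (F/𝒪)(θ)) / H¹_{𝓕_nr}(K_∞, (F/𝒪)(θ))) ≤ Σ_{w∈Sf} λ(𝒫_w(θ))`** — the
`≤` HALF of Keller–Yin / CGLS Prop. 1.2.5's `S`-relaxation corank identity (the tree's typed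
`prop125_residualPair_unrSelmer_corank`, whose `=` is Pollack–Weston 2011 Prop. A.2 ∘ Lemma 1.1.1), IN THE KERNEL:
for `K` imaginary quadratic, `p` odd, `κ` anticyclotomic with topological generator `γ`, any `vbar`, any character
`θ : Γ_K → GL₁(ℤ_p)` with `θ^{p−1} = 1`, and `Sf` = the primes of `K` over `N` with (Heeg) for `N` and `p ∉ w`
(`w ∈ Sf`): `zpCorank (H¹_{𝓕_nr^{Sf}}/H¹_{𝓕_nr}) p ≤ Σ_{w∈Sf} charLocalLambda ∅ κ θ w`. Assembly of the LEAD's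
`zpCorank_unrSelmer_quotient_le_sum_of_loc` (p607760: quotient ↪ product of local factors, `numPlacesAbove κ w` of them
at `w`) with the width seat's per-place bound `zpCorank_le_ite_of_forall_exists` (p609213: `c_w ≤ 𝟙[FrobActsAsNormAt]`);
`charLocalLambda = numPlacesAbove · 𝟙[FrobActsAsNormAt]` by definition.
[cite: KellerYin2024, Prop. 1.2.5 and Lemma 1.1.1 (arXiv:2402.12781v2 TeX L780–800, L455–462)]
[cite: CastellaGrossiLeeSkinner2022, Prop. 1.2.5 (proof, (eq:sur1)–(eq:sur2)), Lemma 1.1.1]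
[cite: GreenbergVatsal2000, §2 pp. 20–23 (Cor. (2.3), Prop. (2.4))] [cite: Brink2007, Thm. 2] -/
theorem zpCorank_unrSelmer_quotient_le_sum_charLocalLambda (hK : IsImaginaryQuadratic K)
    (hp2 : 2 < p) {N : ℕ} (hH : SatisfiesHeegnerHypothesis N K) (κ : ZpExtension K p)
    (hκ : κ.IsAnticyclotomic) {γ : absoluteGaloisGroup K} (hγ : κ.IsTopGenerator γ)
    (vbar : HeightOneSpectrum (𝓞 K))
    (θ : FramedGaloisRep K (padicCoeffIntegers (∅ : Set (PadicAlgCl p))) 1)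
    (hθ : ∀ σ : absoluteGaloisGroup K, θ σ ^ (p - 1) = 1)
    (Sf : Finset (HeightOneSpectrum (𝓞 K)))
    (hSf : ∀ w : HeightOneSpectrum (𝓞 K), w ∈ Sf ↔ ((N : ℤ) : 𝓞 K) ∈ w.asIdeal)
    (hSp : ∀ w ∈ Sf, ((p : ℕ) : 𝓞 K) ∉ w.asIdeal) :
    zpCorank (↥(unrSelmer κ (charModule (∅ : Set (PadicAlgCl p)) θ) vbar
        (↑Sf : Set (HeightOneSpectrum (𝓞 K)))) ⧸
      (unrSelmer κ (charModule (∅ : Set (PadicAlgCl p)) θ) vbar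
          (∅ : Set (HeightOneSpectrum (𝓞 K)))).addSubgroupOf
        (unrSelmer κ (charModule (∅ : Set (PadicAlgCl p)) θ) vbar
          (↑Sf : Set (HeightOneSpectrum (𝓞 K))))) p ≤
      ∑ w ∈ Sf, charLocalLambda (∅ : Set (PadicAlgCl p)) κ θ w := by
  have h := zpCorank_unrSelmer_quotient_le_sum_of_loc κ hγ vbar θ Sf hSp
    (fun w hw ↦ exists_mem_decomp_apply_ne_one_of_heegner hK hp2 hH κ hκ w ((hSf w).mp hw)
      (hSp w hw))
    (fun w ↦ if FrobActsAsNormAt (∅ : Set (PadicAlgCl p)) θ w then 1 else 0)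
    (fun w hw Y hY ↦ zpCorank_le_ite_of_forall_exists θ w κ hθ (hSp w hw) Y hY)
  simpa only [charLocalLambda] using h

/-- **The `≤` half AT A RESIDUAL PAIR** — the same bound for each member `θ ∈ {θsub, θquot}` of a residual pair of
`E[p]` over `K` (`IsResidualPairOver`: both are Teichmüller lifts, `θ^{p−1} = 1`), i.e. under the binders of
`prop125_residualPair_unrSelmer_corank` that the bound actually uses (`K` imaginary quadratic, `2 < p`, (Heeg) for
`N`, `κ` anticyclotomic with a topological generator, `Sf` = primes over `N` not above `p`) and WITHOUT its [RH]
cotorsion hypothesis. [cite: KellerYin2024, Prop. 1.2.5, Lemma 1.1.1, §1.4 display (char to f) (arXiv:2402.12781v2 TeX L780–800, L455–462, L1066–1081)]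
[cite: CastellaGrossiLeeSkinner2022, Prop. 1.2.5] -/
theorem zpCorank_unrSelmer_quotient_le_at_residualPair (hK : IsImaginaryQuadratic K) (hp2 : 2 < p)
    {N : ℕ} (hH : SatisfiesHeegnerHypothesis N K) {WK : WeierstrassCurve K}
    (κ : ZpExtension K p) (hκ : κ.IsAnticyclotomic) {γ : absoluteGaloisGroup K}
    (hγ : κ.IsTopGenerator γ) (vbar : HeightOneSpectrum (𝓞 K))
    (θsub θquot : FramedGaloisRep K (padicCoeffIntegers (∅ : Set (PadicAlgCl p))) 1)
    (hpair : IsResidualPairOver WK p θsub θquot)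
    (Sf : Finset (HeightOneSpectrum (𝓞 K)))
    (hSf : ∀ w : HeightOneSpectrum (𝓞 K), w ∈ Sf ↔ ((N : ℤ) : 𝓞 K) ∈ w.asIdeal)
    (hSp : ∀ w ∈ Sf, ((p : ℕ) : 𝓞 K) ∉ w.asIdeal)
    (θ : FramedGaloisRep K (padicCoeffIntegers (∅ : Set (PadicAlgCl p))) 1) (hθ : θ = θsub ∨ θ = θquot) :
    zpCorank (↥(unrSelmer κ (charModule (∅ : Set (PadicAlgCl p)) θ) vbar
        (↑Sf : Set (HeightOneSpectrum (𝓞 K)))) ⧸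
      (unrSelmer κ (charModule (∅ : Set (PadicAlgCl p)) θ) vbar
          (∅ : Set (HeightOneSpectrum (𝓞 K)))).addSubgroupOf
        (unrSelmer κ (charModule (∅ : Set (PadicAlgCl p)) θ) vbar
          (↑Sf : Set (HeightOneSpectrum (𝓞 K))))) p ≤
      ∑ w ∈ Sf, charLocalLambda (∅ : Set (PadicAlgCl p)) κ θ w := by
  refine zpCorank_unrSelmer_quotient_le_sum_charLocalLambda hK hp2 hH κ hκ hγ vbar θ ?_ Sf hSf hSp
  intro σ
  rcases hθ with rfl | rfl
  · exact (hpair.pow_sub_one σ).1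
  · exact (hpair.pow_sub_one σ).2

end Summit.BirchSwinnertonDyer.BirchSwinnertonDyer.Theorems.UnrSelmerQuotientCorankLocalLambda

end
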